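import Mathlib

/-!
# Crux `ParticleTensorisation` (stmt-AtomisticToContinuum-14367) — `Negative/`:
# the supercritical Curie–Weiss shell bound (file C)

Toward `¬ stub_posdefDressing`: for the Curie–Weiss weights
`W(j) = C(N,j) · exp(β/(2N) · ((2j-N)² - N))` (the total weight of the spin configurations with
`j` plus-spins under `exp((β/N) ∑_{k<l} s_k s_l)`), and `β > 1`, the magnetised shell
`j₁ ≈ N/2 + N(β-1)/(4β)` outweighs the balanced shell `j₀ = ⌈N/2⌉` by a factor `e^{cN}`:
`e^{cN} W(j₀) ≤ W(j₁) = W(N - j₁)` for `N ≥ N₁(β)`. Proof by telescoping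
`W(j+1)/W(j) = ((N-j)/(j+1)) e^{2β(2j+1-N)/N} ≥ e^{2κ(2j-N+1)/N}`, `κ = β(β-1)/(β+1)`, valid while
`0 ≤ 2j - N ≤ N(β-1)/(2β)` (only `1 + y ≤ eʸ` is used — no Stirling formula), and `∑_{i<t}(2i+1) = t²`.
This is the metastability (bimodality of the magnetisation) of the mean-field ferromagnet above
its critical temperature `β = 1`. No auxiliary definitions.
-/

noncomputable section

open Finset Real

namespace Summit.AtomisticToContinuum.BoseEinsteinCondensation.Theorems.PosdefDressingNeg

variable {β : ℝ}

/-- **One telescoping step.** For `β > 1`, `j < N`, `M = 2j - N` with `0 ≤ M ≤ N(β-1)/(2β)`: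
`W(j) · e^{2κ(M+1)/N} ≤ W(j+1)`, `κ = β(β-1)/(β+1)`. [folklore] -/
theorem cw_step (hβ : 1 < β) {N j : ℕ} (hN : 0 < N) (hjN : j < N)
    (hM0 : (N : ℝ) ≤ 2 * j) (hM : (2 * j - N : ℝ) ≤ N * (β - 1) / (2 * β)) :
    (N.choose j : ℝ) * exp (β / (2 * N) * ((2 * j - N : ℝ) ^ 2 - N)) *
        exp (2 * (β * (β - 1) / (β + 1)) / N * ((2 * j - N : ℝ) + 1)) ≤
      (N.choose (j + 1) : ℝ) * exp (β / (2 * N) * ((2 * (j + 1 : ℕ) - N : ℝ) ^ 2 - N)) := by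
  have hβ0 : 0 < β := by linarith
  have hNr : (0 : ℝ) < N := by exact_mod_cast hN
  set M : ℝ := 2 * j - N with hMdef
  set κ : ℝ := β * (β - 1) / (β + 1) with hκ
  set lam : ℝ := 2 * β / (β + 1) with hlam
  have hκlam : κ + lam = β := by rw [hκ, hlam]; field_simp; ring
  -- the binomial recursion `C(N,j+1)(j+1) = C(N,j)(N-j)`
  have hrec : (N.choose (j + 1) : ℝ) * ((j : ℝ) + 1) = (N.choose j : ℝ) * ((N : ℝ) - j) := by
    have h := Nat.choose_succ_right_eq N j
    have h' : ((N.choose (j + 1) * (j + 1) : ℕ) : ℝ) = ((N.choose j * (N - j) : ℕ) : ℝ) := by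
      rw [h]
    push_cast [Nat.cast_sub hjN.le] at h'
    linarith
  have hj1 : (0 : ℝ) < (j : ℝ) + 1 := by positivity
  have hNj : (0 : ℝ) < (N : ℝ) - j := by
    have : (j : ℝ) < N := by exact_mod_cast hjN
    linarith
  -- the key elementary inequality `(j+1) ≤ (N-j) e^{2λ(M+1)/N}`
  have hM1 : 0 ≤ M + 1 := by rw [hMdef]; linarith
  have hlam2 : 0 ≤ lam * ((N : ℝ) - M) - N := by
    rw [hlam]
    have h1 : (N : ℝ) - M ≥ N - N * (β - 1) / (2 * β) := by linarith
    have h2 : 2 * β / (β + 1) * ((N : ℝ) - N * (β - 1) / (2 * β)) = N := by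
      field_simp
      ring
    have h3 : 0 ≤ 2 * β / (β + 1) := by positivity
    nlinarith [mul_le_mul_of_nonneg_left h1 h3]
  have hkey : (j : ℝ) + 1 ≤ ((N : ℝ) - j) * exp (2 * lam / N * (M + 1)) := by
    have h1 : (j : ℝ) + 1 ≤ ((N : ℝ) - j) * (2 * lam / N * (M + 1) + 1) := by
      have e1 : (N : ℝ) - j = (N - M) / 2 := by rw [hMdef]; ring
      have e2 : (j : ℝ) + 1 = (N + M + 2) / 2 := by rw [hMdef]; ring
      rw [e1, e2]
      rw [div_mul_eq_mul_div, le_div_iff₀ (by norm_num : (0 : ℝ) < 2)]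
      have h3 : ((N : ℝ) - M) * (2 * lam / N * (M + 1) + 1) - (N + M + 2) =
          2 * (M + 1) * (lam * (N - M) - N) / N := by
        field_simp
        ring
      have h4 : 0 ≤ 2 * (M + 1) * (lam * (N - M) - N) / N :=
        div_nonneg (mul_nonneg (by positivity) hlam2) hNr.le
      nlinarith [h3, h4]
    exact h1.trans (mul_le_mul_of_nonneg_left (add_one_le_exp _) hNj.le)
  -- assemble
  have hexp1 : β / (2 * N) * ((2 * (j + 1 : ℕ) - N : ℝ) ^ 2 - N) =
      β / (2 * N) * (M ^ 2 - N) + 2 * κ / N * (M + 1) + 2 * lam / N * (M + 1) := by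
    have : 2 * κ / N * (M + 1) + 2 * lam / N * (M + 1) = 2 * β / N * (M + 1) := by
      rw [← hκlam]; ring
    rw [add_assoc, this, hMdef]
    push_cast
    field_simp
    ring
  rw [hexp1, Real.exp_add, Real.exp_add]
  set A : ℝ := (N.choose j : ℝ) * exp (β / (2 * N) * (M ^ 2 - N)) * exp (2 * κ / N * (M + 1))
    with hA
  have hA0 : 0 ≤ A := by positivity
  have hB : (N.choose (j + 1) : ℝ) = (N.choose j : ℝ) * ((N : ℝ) - j) / ((j : ℝ) + 1) := by
    rw [eq_div_iff hj1.ne', hrec]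
  rw [hB]
  have hrhs : (N.choose j : ℝ) * ((N : ℝ) - j) / ((j : ℝ) + 1) *
      (exp (β / (2 * N) * (M ^ 2 - N)) * exp (2 * κ / N * (M + 1)) * exp (2 * lam / N * (M + 1))) =
      A * (((N : ℝ) - j) * exp (2 * lam / N * (M + 1)) / ((j : ℝ) + 1)) := by
    rw [hA]; field_simp
  rw [hrhs]
  calc A = A * 1 := (mul_one A).symm
    _ ≤ A * (((N : ℝ) - j) * exp (2 * lam / N * (M + 1)) / ((j : ℝ) + 1)) :=
        mul_le_mul_of_nonneg_left ((one_le_div hj1).mpr hkey) hA0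

/-- `∑_{i<t} (M₀ + 2i + 1) ≥ t²` for `M₀ ≥ 0`. [folklore] -/
theorem sq_le_sum_range {M₀ : ℝ} (hM₀ : 0 ≤ M₀) (t : ℕ) :
    (t : ℝ) ^ 2 ≤ ∑ i ∈ range t, (M₀ + 2 * i + 1) := by
  induction t with
  | zero => simp
  | succ t ih =>
    rw [sum_range_succ]
    push_cast
    nlinarith [ih]

/-- **Telescoped shell bound.** From `j₀` with `M₀ = 2j₀ - N ∈ [0,1]`, after `t` steps
(`2t ≤ N(β-1)/(2β) + 1`, `j₀ + t ≤ N`): `W(j₀) e^{2κ t²/N} ≤ W(j₀ + t)`. [folklore] -/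
theorem cw_iter (hβ : 1 < β) {N j₀ : ℕ} (hN : 0 < N) (hM00 : (N : ℝ) ≤ 2 * j₀)
    (hM01 : (2 * j₀ - N : ℝ) ≤ 1) (t : ℕ) (ht : 2 * (t : ℝ) ≤ N * (β - 1) / (2 * β) + 1)
    (htN : j₀ + t ≤ N) :
    (N.choose j₀ : ℝ) * exp (β / (2 * N) * ((2 * j₀ - N : ℝ) ^ 2 - N)) *
        exp (2 * (β * (β - 1) / (β + 1)) / N * (t : ℝ) ^ 2) ≤
      (N.choose (j₀ + t) : ℝ) * exp (β / (2 * N) * ((2 * (j₀ + t : ℕ) - N : ℝ) ^ 2 - N)) := by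
  have hβ0 : 0 < β := by linarith
  have hNr : (0 : ℝ) < N := by exact_mod_cast hN
  set κ : ℝ := β * (β - 1) / (β + 1) with hκ
  have hκ0 : 0 ≤ κ := by rw [hκ]; exact div_nonneg (mul_nonneg hβ0.le (by linarith)) (by linarith)
  -- induction with the exact telescoped exponent, then compare with `t²`
  have main : ∀ s : ℕ, 2 * (s : ℝ) ≤ N * (β - 1) / (2 * β) + 1 → j₀ + s ≤ N →
      (N.choose j₀ : ℝ) * exp (β / (2 * N) * ((2 * j₀ - N : ℝ) ^ 2 - N)) *
          exp (2 * κ / N * ∑ i ∈ range s, ((2 * j₀ - N : ℝ) + 2 * i + 1)) ≤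
        (N.choose (j₀ + s) : ℝ) * exp (β / (2 * N) * ((2 * (j₀ + s : ℕ) - N : ℝ) ^ 2 - N)) := by
    intro s
    induction s with
    | zero =>
      intro _ _
      simp
    | succ s ih =>
      intro hs hsN
      have hs' : 2 * (s : ℝ) ≤ N * (β - 1) / (2 * β) + 1 := by push_cast at hs; linarith
      have ih' := ih hs' (by omega)
      rw [sum_range_succ, mul_add, Real.exp_add, ← mul_assoc]
      refine (mul_le_mul_of_nonneg_right ih' (exp_pos _).le).trans ?_
      have hstep := cw_step hβ hN (j := j₀ + s) (by omega) (by push_cast; linarith)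
        (by push_cast; push_cast at hs; linarith)
      have e1 : (2 * (j₀ + s : ℕ) - N : ℝ) + 1 = (2 * j₀ - N : ℝ) + 2 * s + 1 := by
        push_cast; ring
      have e2 : (j₀ + s + 1 : ℕ) = j₀ + (s + 1) := by omega
      rw [e1, e2] at hstep
      exact hstep
  have h1 := main t ht htN
  refine le_trans ?_ h1
  refine mul_le_mul_of_nonneg_left (exp_le_exp.mpr ?_) (by positivity)
  exact mul_le_mul_of_nonneg_left (sq_le_sum_range (by linarith) t)
    (div_nonneg (mul_nonneg (by norm_num) hκ0) hNr.le)

/-- **Supercritical Curie–Weiss shells.** For `β > 1` there are `c > 0` and `N₁` such that for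
all `N ≥ N₁` some shell `j₁` with `⌈N/2⌉ < j₁ ≤ N` (positive magnetisation `2j₁ - N ≥ 2`) satisfies
`e^{cN} W(⌈N/2⌉) ≤ W(j₁)`, and the mirror shell `N - j₁` has the same weight. [folklore] -/
theorem cw_shells (hβ : 1 < β) : ∃ c : ℝ, 0 < c ∧ ∃ N₁ : ℕ, 2 ≤ N₁ ∧ ∀ N : ℕ, N₁ ≤ N →
    ∃ j₁ : ℕ, (N + 1) / 2 < j₁ ∧ j₁ ≤ N ∧
      exp (c * N) * ((N.choose ((N + 1) / 2) : ℝ) *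
          exp (β / (2 * N) * ((2 * ((N + 1) / 2 : ℕ) - N : ℝ) ^ 2 - N))) ≤
        (N.choose j₁ : ℝ) * exp (β / (2 * N) * ((2 * j₁ - N : ℝ) ^ 2 - N)) ∧
      (N.choose (N - j₁) : ℝ) * exp (β / (2 * N) * ((2 * (N - j₁ : ℕ) - N : ℝ) ^ 2 - N)) =
        (N.choose j₁ : ℝ) * exp (β / (2 * N) * ((2 * j₁ - N : ℝ) ^ 2 - N)) := by
  have hβ0 : 0 < β := by linarith
  obtain ⟨κ, hκ⟩ : ∃ κ : ℝ, κ = β * (β - 1) / (β + 1) := ⟨_, rfl⟩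
  obtain ⟨γ, hγ⟩ : ∃ γ : ℝ, γ = (β - 1) / (4 * β) := ⟨_, rfl⟩
  have hγ0 : 0 < γ := by rw [hγ]; exact div_pos (by linarith) (by positivity)
  have hγ4 : γ ≤ 1 / 4 := by
    rw [hγ, div_le_div_iff₀ (by positivity) (by norm_num)]
    nlinarith
  have hκ0 : 0 < κ := by rw [hκ]; exact div_pos (mul_pos hβ0 (by linarith)) (by linarith)
  refine ⟨κ * γ ^ 2 / 2, by positivity, max 2 (⌈2 / γ⌉₊), le_max_left _ _, fun N hN => ?_⟩
  have hN2 : 2 ≤ N := le_trans (le_max_left _ _) hN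
  have hNr : (2 : ℝ) ≤ N := by exact_mod_cast hN2
  have hNpos : 0 < N := by omega
  have hNr0 : (0 : ℝ) < N := by linarith
  have hγN : 2 ≤ γ * N := by
    have h1 : (⌈2 / γ⌉₊ : ℝ) ≤ N := by exact_mod_cast le_trans (le_max_right _ _) hN
    have h2 : 2 / γ ≤ (⌈2 / γ⌉₊ : ℝ) := Nat.le_ceil _
    have h3 : 2 / γ ≤ N := h2.trans h1
    rwa [div_le_iff₀ hγ0, mul_comm] at h3
  set j₀ : ℕ := (N + 1) / 2 with hj₀
  set t : ℕ := ⌊γ * N⌋₊ with ht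
  have htle : (t : ℝ) ≤ γ * N := Nat.floor_le (by positivity)
  have htge : γ * N - 1 ≤ t := by
    have := Nat.lt_floor_add_one (γ * N)
    rw [← ht] at this
    linarith
  -- facts about `j₀ = ⌈N/2⌉`
  have hj₀2 : 2 * j₀ ≤ N + 1 := by rw [hj₀]; omega
  have hj₀le : 2 * (j₀ : ℝ) ≤ N + 1 := by exact_mod_cast hj₀2
  have hj₀ge : (N : ℝ) ≤ 2 * j₀ := by
    have : N ≤ 2 * j₀ := by rw [hj₀]; omega
    exact_mod_cast this
  have hM01 : (2 * j₀ - N : ℝ) ≤ 1 := by linarith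
  -- the step count is admissible
  have htt : 2 * (t : ℝ) ≤ N * (β - 1) / (2 * β) + 1 := by
    have : 2 * (γ * N) = N * (β - 1) / (2 * β) := by rw [hγ]; field_simp; ring
    linarith
  have ht4 : (t : ℝ) ≤ N / 4 := htle.trans (by nlinarith)
  have htN : j₀ + t ≤ N := by
    have h1 : (j₀ : ℝ) + t ≤ N := by linarith
    exact_mod_cast h1
  have ht1 : 1 ≤ t := by
    have : (1 : ℝ) ≤ t := by linarith
    exact_mod_cast this
  refine ⟨j₀ + t, by omega, htN, ?_, ?_⟩
  · -- the exponential gain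
    have h := cw_iter hβ hNpos hj₀ge hM01 t htt htN
    rw [← hκ] at h
    have hW0 : 0 ≤ (N.choose j₀ : ℝ) * exp (β / (2 * N) * ((2 * j₀ - N : ℝ) ^ 2 - N)) := by
      positivity
    have hcmp : κ * γ ^ 2 / 2 * N ≤ 2 * κ / N * (t : ℝ) ^ 2 := by
      have ht2 : γ * N / 2 ≤ t := by linarith
      have ht2' : (γ * N / 2) ^ 2 ≤ (t : ℝ) ^ 2 := pow_le_pow_left₀ (by positivity) ht2 2
      have e1 : 2 * κ / N * (t : ℝ) ^ 2 = (2 * κ * (t : ℝ) ^ 2) / N := by ring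
      rw [e1, le_div_iff₀ hNr0]
      have e2 : κ * γ ^ 2 / 2 * N * N = 2 * κ * (γ * N / 2) ^ 2 := by ring
      rw [e2]
      nlinarith [ht2', hκ0.le]
    calc exp (κ * γ ^ 2 / 2 * N) *
          ((N.choose j₀ : ℝ) * exp (β / (2 * N) * ((2 * j₀ - N : ℝ) ^ 2 - N)))
        = (N.choose j₀ : ℝ) * exp (β / (2 * N) * ((2 * j₀ - N : ℝ) ^ 2 - N)) *
            exp (κ * γ ^ 2 / 2 * N) := mul_comm _ _
      _ ≤ (N.choose j₀ : ℝ) * exp (β / (2 * N) * ((2 * j₀ - N : ℝ) ^ 2 - N)) *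
            exp (2 * κ / N * (t : ℝ) ^ 2) :=
          mul_le_mul_of_nonneg_left (exp_le_exp.mpr hcmp) hW0
      _ ≤ _ := h
  · -- the mirror shell
    rw [Nat.choose_symm htN]
    congr 2
    push_cast [Nat.cast_sub htN]
    ring

/-- `e^{cN}` eventually beats any linear function: for `c > 0` and every `K` there is `N₀` with
`K N < e^{cN}` for `N ≥ N₀`. [folklore] -/
theorem exists_nat_mul_lt_exp {c : ℝ} (hc : 0 < c) (K : ℝ) :
    ∃ N₀ : ℕ, ∀ N : ℕ, N₀ ≤ N → K * N < exp (c * N) := by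
  refine ⟨⌈4 * (|K| + 1) / c ^ 2⌉₊ + 1, fun N hN => ?_⟩
  have hN1 : 4 * (|K| + 1) / c ^ 2 < N := by
    have h1 : (⌈4 * (|K| + 1) / c ^ 2⌉₊ : ℝ) + 1 ≤ N := by exact_mod_cast hN
    have h2 := Nat.le_ceil (4 * (|K| + 1) / c ^ 2)
    linarith
  have hNpos : (0 : ℝ) < N := lt_of_le_of_lt (by positivity) hN1
  have hhalf : c * N / 2 + 1 ≤ exp (c * N / 2) := add_one_le_exp _
  have hsq : exp (c * N) = exp (c * N / 2) ^ 2 := by rw [← Real.exp_nat_mul]; ring_nf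
  have h3 : (c * N / 2) ^ 2 ≤ exp (c * N) := by
    rw [hsq]
    exact pow_le_pow_left₀ (by positivity) (by linarith) 2
  have h4 : K * N < (c * N / 2) ^ 2 := by
    have h5 : K * N ≤ |K| * N := mul_le_mul_of_nonneg_right (le_abs_self K) hNpos.le
    have h6 : 4 * (|K| + 1) < c ^ 2 * N := by
      rw [div_lt_iff₀ (by positivity)] at hN1
      linarith
    nlinarith [abs_nonneg K]
  linarith

end Summit.AtomisticToContinuum.BoseEinsteinCondensation.Theorems.PosdefDressingNeg

end
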